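import Literature.NumberTheory.Sieve.BombieriAsymptoticSieveTreeTheorem
import Literature.NumberTheory.Sieve.BombieriAsymptoticSieveGeneralHyp
import HarnessLib

/-!
# The prime mass under the hypotheses of Bombieri's asymptotic sieve is at most `(2 + ε) H x`

Topic `Literature/NumberTheory/Sieve`, companion ("Proofs") file of `ParityBarrier.lean`
(parity.S32 (ii)), kept separate because it imports the tree's proof of Bombieri's asymptotic
sieve (`BombieriAsymptoticSieveTreeTheorem.lean`), which lies downstream of `ParityBarrier.lean`
and `ParityBarrierProofs.lean`. Everything here is PROVED (theorems only, no new definitions, no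
named facts): `prime_mass_le_two_holds : prime_mass_le_two`.

## The statement

`Literature.NumberTheory.Sieve.prime_mass_le_two` (`ParityBarrier.lean`): for a sifted sequence
`𝒜 = (a_n)` with `X(x) = x`, density of sieve dimension `1` with
`∑_{p ≤ x} g(p) log p = log x + c + O_B((log x)^{−B})`, singular-series constant `H`, level of
distribution `x^θ` for every `θ < 1` and `∑_{n ≤ x} a_n² ≪ x (log x)^C` — i.e. exactly the
hypotheses of the tree's `Literature.NumberTheory.Sieve.bombieri_asymptotic_sieve` — and every
`ε > 0`, one has `∑_{n ≤ x} Λ(n) a_n ≤ (2 + ε) H x` for all large `x`: the upper half `δ ≤ 2`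
of Bombieri's indeterminacy range `δ ∈ [0, 2]` for the case `k = 1` of the asymptotic sieve
(Bombieri, *The asymptotic sieve* (1976), §1 [BombieriAsymptoticSieve1976]; Friedlander,
*Producing prime numbers via sieve methods*, LNM 1891 (2006), §1 "Bombieri's Sieve", p. 11:
"Bombieri showed that `0 ≤ α ≤ 2`" [Friedlander2006ProducingPrimes]).

## The proof (Bombieri's argument through `Λ₂`, as in [Friedlander2006ProducingPrimes] §1, pp. 10–11)

1. The case `k = 2` of the asymptotic sieve is a theorem of the tree under these very hypotheses
   (`bombieri_asymptotic_sieve_holds`, file `BombieriAsymptoticSieveTreeTheorem.lean`):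
   `S₂(x) = ∑_{n ≤ x} Λ₂(n) a_n ∼ 2 H x log x`.
2. `Λ₂ = Λ · log + Λ ⋆ Λ` (`generalizedVonMangoldt_succ_apply`, `generalizedVonMangoldt_one`)
   with both terms nonnegative, so `Λ(n) log n ≤ Λ₂(n)`
   (`vonMangoldt_mul_log_le_generalizedVonMangoldt_two`) and hence
   `T(x) := ∑_{n ≤ x} Λ(n) log n · a_n ≤ S₂(x) ≤ (2 + ε/4) H x log x` for large `x`.
3. Removing the logarithm (`sum_vonMangoldt_mul_le_split`): with `y = x^{1−η}`,
   `∑_{n ≤ x} Λ(n) a_n ≤ T(y)/log 2 + T(x)/((1 − η) log x)`, because `Λ(n) ≠ 0` forces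
   `log n ≥ log 2`, and `n > y` forces `log n ≥ (1 − η) log x`. With `η = ε/(8 + 2ε)` the second
   term is at most `(2 + ε/4) H x/(1 − η) = (2 + ε/2) H x`, and the first is
   `≤ (2 + ε/4) H x^{1−η} log x / log 2 ≤ (ε/2) H x` for large `x` since `log x = o(x^η)`
   (`isLittleO_log_rpow_atTop`) and `H > 0` (`BombieriSieve.densityConstant_pos`).

## References

* E. Bombieri, *The asymptotic sieve*, Rend. Accad. Naz. XL (5) 1/2 (1975/76), 243–269, §1.
  [BombieriAsymptoticSieve1976] (not held; statement via Friedlander 2006).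
* J. B. Friedlander, *Producing prime numbers via sieve methods*, in: Analytic Number Theory
  (Cetraro 2002), LNM 1891 (2006), 1–49, §1 "Bombieri's Sieve" (read at PDF pp. 19–21: the
  recursion `Λ_{k+1} = Λ_k L + Λ_k ⋆ Λ`, `0 ≤ Λ_k ≤ (log n)^k`, `Λ₂ = Λ log + Λ ⋆ Λ`, Theorem
  (Bombieri) for `k ≥ 2`, and "Bombieri showed that `0 ≤ α ≤ 2`"). [Friedlander2006ProducingPrimes]
* J. Friedlander, H. Iwaniec, *On Bombieri's asymptotic sieve*, Ann. Scuola Norm. Sup. Pisa (4) 5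
  (1978), 719–756, Theorem 1. [FriedlanderIwaniecPisa1978]
-/

noncomputable section

open Filter Asymptotics Finset
open scoped ArithmeticFunction.vonMangoldt Topology

namespace Literature.NumberTheory.Sieve

/-- `Λ(n) log n ≤ Λ₂(n)`: the case `k = 1` of the recursion `Λ_{k+1} = Λ_k · log + Λ ⋆ Λ_k`
gives `Λ₂(n) = Λ(n) log n + ∑_{ab = n} Λ(a) Λ(b)` with a nonnegative convolution term
(Friedlander, LNM 1891 (2006), §1, p. 10; Bombieri 1976 §1). [cite: Friedlander2006ProducingPrimes, §1 "Bombieri's Sieve", p. 10 (Λ₂ = Λ log + Λ ⋆ Λ)] -/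
theorem vonMangoldt_mul_log_le_generalizedVonMangoldt_two (n : ℕ) :
    Λ n * Real.log n ≤ generalizedVonMangoldt 2 n := by
  have h := generalizedVonMangoldt_succ_apply 1 n
  rw [generalizedVonMangoldt_one] at h
  calc Λ n * Real.log n
      ≤ Λ n * Real.log n + ∑ x ∈ n.divisorsAntidiagonal, Λ x.1 * Λ x.2 :=
        le_add_of_nonneg_right (Finset.sum_nonneg fun x _ =>
          mul_nonneg ArithmeticFunction.vonMangoldt_nonneg ArithmeticFunction.vonMangoldt_nonneg)
    _ = generalizedVonMangoldt (1 + 1) n := h.symm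
    _ = generalizedVonMangoldt 2 n := rfl

/-- Removing the logarithm (elementary splitting at `y = x^{1−η}`): for `x ≥ 2`, `0 < η < 1` and
any sifted sequence,
`∑_{n ≤ x} Λ(n) a_n ≤ (∑_{n ≤ y} Λ(n) log n · a_n)/log 2 + (∑_{n ≤ x} Λ(n) log n · a_n)/((1 − η) log x)`,
since `Λ(n) ≠ 0 ⇒ n ≥ 2 ⇒ log n ≥ log 2` on `n ≤ y`, and `log n ≥ log y = (1 − η) log x` on
`y < n ≤ x` (the usual passage from `∑ Λ(n) log n · a_n` to `∑ Λ(n) a_n`). [folklore] -/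
theorem sum_vonMangoldt_mul_le_split (A : SieveSequence) {x η : ℝ} (hx : 2 ≤ x) (hη0 : 0 < η)
    (hη1 : η < 1) :
    ∑ n ∈ Ioc 0 ⌊x⌋₊, Λ n * A.a n ≤
      (∑ n ∈ Ioc 0 ⌊x ^ (1 - η)⌋₊, Λ n * Real.log n * A.a n) / Real.log 2 +
        (∑ n ∈ Ioc 0 ⌊x⌋₊, Λ n * Real.log n * A.a n) / ((1 - η) * Real.log x) := by
  have hx0 : 0 < x := by linarith
  have hlogx : 0 < Real.log x := Real.log_pos (by linarith)
  have hlog2 : 0 < Real.log 2 := Real.log_pos one_lt_two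
  have hc : 0 < (1 - η) * Real.log x := mul_pos (by linarith) hlogx
  have hy : Real.log (x ^ (1 - η)) = (1 - η) * Real.log x := Real.log_rpow hx0 _
  have hnn : ∀ n : ℕ, 0 ≤ Λ n * Real.log n * A.a n := fun n =>
    mul_nonneg (mul_nonneg ArithmeticFunction.vonMangoldt_nonneg (Real.log_natCast_nonneg n))
      (A.a_nonneg n)
  rw [← Finset.sum_filter_add_sum_filter_not (Ioc 0 ⌊x⌋₊) (fun n => n ≤ ⌊x ^ (1 - η)⌋₊)]
  refine add_le_add ?_ ?_
  · -- the range `n ≤ y`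
    calc ∑ n ∈ (Ioc 0 ⌊x⌋₊).filter (fun n => n ≤ ⌊x ^ (1 - η)⌋₊), Λ n * A.a n
        ≤ ∑ n ∈ Ioc 0 ⌊x ^ (1 - η)⌋₊, Λ n * A.a n := by
          refine Finset.sum_le_sum_of_subset_of_nonneg ?_ fun n _ _ =>
            mul_nonneg ArithmeticFunction.vonMangoldt_nonneg (A.a_nonneg n)
          intro n hn
          rw [Finset.mem_filter, Finset.mem_Ioc] at hn
          exact Finset.mem_Ioc.mpr ⟨hn.1.1, hn.2⟩
      _ ≤ ∑ n ∈ Ioc 0 ⌊x ^ (1 - η)⌋₊, Λ n * Real.log n * A.a n / Real.log 2 := by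
          refine Finset.sum_le_sum fun n _ => ?_
          rw [le_div_iff₀ hlog2]
          by_cases hn : Λ n = 0
          · simp [hn]
          · have h2n : (2 : ℝ) ≤ n := by
              exact_mod_cast (ArithmeticFunction.vonMangoldt_ne_zero_iff.mp hn).two_le
            calc Λ n * A.a n * Real.log 2 ≤ Λ n * A.a n * Real.log n :=
                  mul_le_mul_of_nonneg_left (Real.log_le_log two_pos h2n)
                    (mul_nonneg ArithmeticFunction.vonMangoldt_nonneg (A.a_nonneg n))
              _ = Λ n * Real.log n * A.a n := by ring
      _ = (∑ n ∈ Ioc 0 ⌊x ^ (1 - η)⌋₊, Λ n * Real.log n * A.a n) / Real.log 2 := by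
          rw [Finset.sum_div]
  · -- the range `y < n ≤ x`
    calc ∑ n ∈ (Ioc 0 ⌊x⌋₊).filter (fun n => ¬ n ≤ ⌊x ^ (1 - η)⌋₊), Λ n * A.a n
        ≤ ∑ n ∈ (Ioc 0 ⌊x⌋₊).filter (fun n => ¬ n ≤ ⌊x ^ (1 - η)⌋₊),
            Λ n * Real.log n * A.a n / ((1 - η) * Real.log x) := by
          refine Finset.sum_le_sum fun n hn => ?_
          rw [Finset.mem_filter, not_le] at hn
          have hyn : x ^ (1 - η) < n := Nat.lt_of_floor_lt hn.2
          have hlogn : (1 - η) * Real.log x ≤ Real.log n := by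
            rw [← hy]
            exact Real.log_le_log (Real.rpow_pos_of_pos hx0 _) hyn.le
          rw [le_div_iff₀ hc]
          calc Λ n * A.a n * ((1 - η) * Real.log x) ≤ Λ n * A.a n * Real.log n :=
                mul_le_mul_of_nonneg_left hlogn
                  (mul_nonneg ArithmeticFunction.vonMangoldt_nonneg (A.a_nonneg n))
            _ = Λ n * Real.log n * A.a n / 1 := by ring
            _ = Λ n * Real.log n * A.a n := div_one _
      _ = (∑ n ∈ (Ioc 0 ⌊x⌋₊).filter (fun n => ¬ n ≤ ⌊x ^ (1 - η)⌋₊),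
            Λ n * Real.log n * A.a n) / ((1 - η) * Real.log x) := by
          rw [Finset.sum_div]
      _ ≤ (∑ n ∈ Ioc 0 ⌊x⌋₊, Λ n * Real.log n * A.a n) / ((1 - η) * Real.log x) :=
          div_le_div_of_nonneg_right
            (Finset.sum_le_sum_of_subset_of_nonneg (Finset.filter_subset _ _)
              fun n _ _ => hnn n) hc.le

/-- **Discharge of `prime_mass_le_two`** (parity.S32 (ii), upper half of Bombieri's
indeterminacy range for `k = 1`; Bombieri, *The asymptotic sieve* (1976), §1; Friedlander,
LNM 1891 (2006), §1 "Bombieri's Sieve", p. 11: "Bombieri showed that `0 ≤ α ≤ 2`"). Under the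
hypotheses of the tree's `bombieri_asymptotic_sieve` (size `x`, dimension `1`, linear density,
singular-series constant `H`, level `x^θ` for all `θ < 1`, crude second moment), for every `ε > 0`,
`∑_{n ≤ x} Λ(n) a_n ≤ (2 + ε) H x` for all large `x`. Proof: the case `k = 2` of the asymptotic
sieve (`bombieri_asymptotic_sieve_holds`) gives `∑_{n ≤ x} Λ(n) log n · a_n ≤ ∑ Λ₂(n) a_n ≤
(2 + ε/4) H x log x` eventually (`Λ log ≤ Λ₂`), and the logarithm is removed by
`sum_vonMangoldt_mul_le_split` with `η = ε/(8 + 2ε)`, the short initial range `n ≤ x^{1−η}`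
contributing `≤ (ε/2) H x` because `log x = o(x^η)` and `H > 0`. [cite: Friedlander2006ProducingPrimes, §1 "Bombieri's Sieve", p. 11 (0 ≤ α ≤ 2; after Bombieri 1976 §1)] -/
theorem prime_mass_le_two_holds : prime_mass_le_two := by
  intro A H c hsize hdim hlin hH hlevel hcrude ε hε
  obtain ⟨K, hK⟩ := hdim
  have hH0 : 0 < H := (BombieriSieve.densityConstant_pos A hK hH).2
  -- Bombieri's asymptotic sieve for `k = 2`, under exactly the present hypotheses
  have h2 := bombieri_asymptotic_sieve_holds 2 le_rfl A H c hsize ⟨K, hK⟩ hlin hH hlevel hcrude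
  -- `T(x) = ∑_{n ≤ x} Λ(n) log n a_n ≤ S₂(x) ≤ (2 + ε/4) H x log x` eventually
  have hT : ∀ᶠ x : ℝ in atTop,
      ∑ n ∈ Ioc 0 ⌊x⌋₊, Λ n * Real.log n * A.a n ≤ (2 + ε / 4) * H * x * Real.log x := by
    have hlo := h2.isLittleO.def (show (0 : ℝ) < ε / 8 by positivity)
    filter_upwards [hlo, eventually_ge_atTop (1 : ℝ)] with x hx hx1
    have hL : 0 ≤ Real.log x := Real.log_nonneg hx1
    have hmain : 0 ≤ 2 * H * x * Real.log x := by positivity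
    have hx' : ∑ n ∈ Ioc 0 ⌊x⌋₊, generalizedVonMangoldt 2 n * A.a n - 2 * H * x * Real.log x ≤
        ε / 8 * (2 * H * x * Real.log x) := by
      simp only [Pi.sub_apply, Nat.cast_ofNat, Nat.reduceSub, pow_one, Real.norm_eq_abs,
        abs_of_nonneg hmain] at hx
      exact (abs_le.mp hx).2
    calc ∑ n ∈ Ioc 0 ⌊x⌋₊, Λ n * Real.log n * A.a n
        ≤ ∑ n ∈ Ioc 0 ⌊x⌋₊, generalizedVonMangoldt 2 n * A.a n :=
          Finset.sum_le_sum fun n _ => mul_le_mul_of_nonneg_right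
            (vonMangoldt_mul_log_le_generalizedVonMangoldt_two n) (A.a_nonneg n)
      _ ≤ 2 * H * x * Real.log x + ε / 8 * (2 * H * x * Real.log x) := by linarith
      _ = (2 + ε / 4) * H * x * Real.log x := by ring
  -- the constants `η = ε/(8 + 2ε)` and `κ` with `(2 + ε/4) H κ = (ε/2) H log 2`
  obtain ⟨η, hη⟩ : ∃ η : ℝ, η = ε / (8 + 2 * ε) := ⟨_, rfl⟩
  have h8 : (0 : ℝ) < 8 + 2 * ε := by positivity
  have hη0 : 0 < η := by rw [hη]; positivity
  have hη1 : η < 1 := by rw [hη, div_lt_one h8]; linarith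
  have hkey : (2 + ε / 4) = (2 + ε / 2) * (1 - η) := by
    rw [hη]
    field_simp
    ring
  have hc1 : (0 : ℝ) < (2 + ε / 4) * H := by positivity
  obtain ⟨κ, hκ⟩ : ∃ κ : ℝ, κ = ε / 2 * H * Real.log 2 / ((2 + ε / 4) * H) := ⟨_, rfl⟩
  have hlog2 : 0 < Real.log 2 := Real.log_pos one_lt_two
  have hκ0 : 0 < κ := by rw [hκ]; positivity
  have hκkey : (2 + ε / 4) * H * κ = ε / 2 * H * Real.log 2 := by
    rw [hκ]
    field_simp
  -- `T` at the scale `y = x^{1−η} → ∞`, and `log x ≤ κ x^η` eventually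
  have hTy := (tendsto_rpow_atTop (by linarith : (0 : ℝ) < 1 - η)).eventually hT
  have hlog := (isLittleO_log_rpow_atTop hη0).def hκ0
  filter_upwards [hT, hTy, hlog, eventually_ge_atTop (2 : ℝ)] with x hx hxy hlx hx2
  have hx0 : 0 < x := by linarith
  have hlogx : 0 < Real.log x := Real.log_pos (by linarith)
  have hy0 : 0 < x ^ (1 - η) := Real.rpow_pos_of_pos hx0 _
  have hlogy : Real.log (x ^ (1 - η)) = (1 - η) * Real.log x := Real.log_rpow hx0 _
  -- the short range `n ≤ y`: `T(y)/log 2 ≤ (ε/2) H x`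
  have hsmall : (∑ n ∈ Ioc 0 ⌊x ^ (1 - η)⌋₊, Λ n * Real.log n * A.a n) / Real.log 2 ≤
      ε / 2 * H * x := by
    rw [div_le_iff₀ hlog2]
    refine hxy.trans ?_
    rw [Real.norm_eq_abs, Real.norm_eq_abs, abs_of_nonneg hlogx.le,
      abs_of_nonneg (Real.rpow_nonneg hx0.le _)] at hlx
    have h1 : Real.log (x ^ (1 - η)) ≤ Real.log x := by
      rw [hlogy]
      exact mul_le_of_le_one_left hlogx.le (by linarith)
    have h2' : x ^ (1 - η) * Real.log x ≤ κ * x := by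
      calc x ^ (1 - η) * Real.log x ≤ x ^ (1 - η) * (κ * x ^ η) :=
            mul_le_mul_of_nonneg_left hlx hy0.le
        _ = κ * (x ^ (1 - η) * x ^ η) := by ring
        _ = κ * x := by rw [← Real.rpow_add hx0, sub_add_cancel, Real.rpow_one]
    calc (2 + ε / 4) * H * x ^ (1 - η) * Real.log (x ^ (1 - η))
        ≤ (2 + ε / 4) * H * (x ^ (1 - η) * Real.log x) := by
          rw [mul_assoc ((2 + ε / 4) * H)]
          exact mul_le_mul_of_nonneg_left (mul_le_mul_of_nonneg_left h1 hy0.le) hc1.le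
      _ ≤ (2 + ε / 4) * H * (κ * x) := mul_le_mul_of_nonneg_left h2' hc1.le
      _ = (2 + ε / 4) * H * κ * x := by ring
      _ = ε / 2 * H * x * Real.log 2 := by rw [hκkey]; ring
  -- the long range `y < n ≤ x`: `T(x)/((1−η) log x) ≤ (2 + ε/2) H x`
  have hlarge : (∑ n ∈ Ioc 0 ⌊x⌋₊, Λ n * Real.log n * A.a n) / ((1 - η) * Real.log x) ≤
      (2 + ε / 2) * H * x := by
    rw [div_le_iff₀ (mul_pos (by linarith) hlogx)]
    calc ∑ n ∈ Ioc 0 ⌊x⌋₊, Λ n * Real.log n * A.a n ≤ (2 + ε / 4) * H * x * Real.log x := hx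
      _ = (2 + ε / 2) * H * x * ((1 - η) * Real.log x) := by rw [hkey]; ring
  calc ∑ n ∈ Ioc 0 ⌊x⌋₊, Λ n * A.a n ≤ _ := sum_vonMangoldt_mul_le_split A hx2 hη0 hη1
    _ ≤ ε / 2 * H * x + (2 + ε / 2) * H * x := add_le_add hsmall hlarge
    _ = (2 + ε) * H * x := by ring

end Literature.NumberTheory.Sieve
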